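/-
Copyright (c) 2026. All rights reserved.
Released under Apache 2.0 license as described in the file LICENSE.
-/
import Summits.HubbardSuperconductivity.HubbardLadder.HubbardRowsOfClaims
import Literature.MathematicalPhysics.QuantumLattice.HubbardPseudospinIsotropy
import HarnessLib

/-!
# R2 rows: certified CEILINGS on the s-wave pair, charge and density correlators of the half-filled
# `4 × 4` Hubbard torus at EVERY fixed distance, and the uniform density `⟨n_{xσ}⟩ = ½` (device D10)

HONEST FRAMING: ladder R1–R4 with certified numbers; no claim on H/H₀.

Device D10 (pseudospin isotropy, `Literature/…/HubbardPseudospinIsotropy`, all PROVED there): every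
half-filled ground state `ψ` of the repulsive Hubbard model on the even square torus is a pseudospin singlet, so
for every displacement `r ≠ 0`
`Σ_x ⟨(n_x - 1)(n_{x+r} - 1)⟩ = 2 ε_r Σ_x ⟨Δ†_x Δ_{x+r}⟩` (`ε_r = (-1)^{r₁+r₂}`, `Δ†_x = c†_{x↑}c†_{x↓}`),
`|Σ_x ⟨Δ†_x Δ_{x+r}⟩| ≤ Re⟨D̂⟩` (Cauchy–Schwarz, any `r`), and `⟨n_{xσ}⟩ = ½` (Lieb–Loss–McCann), hence
`Σ_x ⟨n_x n_{x+r}⟩ - 16 = 2 ε_r Σ_x ⟨Δ†_x Δ_{x+r}⟩`. Composed with the double-occupancy brackets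
`d = ⟨D̂⟩/16 ≤ d_hi(U)` of `HubbardRowsOfClaims` (claim form: typed claim nodes for the INHERITED pub-mbboot
energy certificates, LEAN REQUESTS #39.2/#48/#51) this gives, for `U ∈ {2, 4, 6, 8}`, `t = 1`:

* `P̄_s(r) := (1/16) |Σ_x ⟨ψ, Δ†_x Δ_{x+r} ψ⟩| ≤ d_hi(U)` for every `r` (translation-averaged on-site s-wave
  pair correlator; at `r = 0` this is `d` itself);
* `C̄_c(r) := (1/16) |Σ_x ⟨ψ, (n_x - 1)(n_{x+r} - 1) ψ⟩| ≤ 2 d_hi(U)` and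
  `|(1/16) Σ_x ⟨ψ, n_x n_{x+r} ψ⟩ - 1| ≤ 2 d_hi(U)` for every `r ≠ 0` (connected density–density correlator,
  `⟨n_x⟩ = 1` exactly);

with `d_hi = 0.1870 (U=2), 0.1622 | 0.1422 (U=4), 0.1386 | 0.1090 (U=6), 0.1153 | 0.0827 (U=8)` for the
one-node (`_of_claim`: E2 upper node at `U` only) | three-node (`_of_claims`) forms. Certificate-free rows
(every `U > 0`): `⟨n_{xσ}⟩ = ½`, `⟨n_x⟩ = 1`, and the charge/pair identity.

HONEST LIMITS: these are `O(d)` CEILINGS at every distance — no decay, no sign beyond the identity, no floor;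
half filling `n = 1` and `t' = 0` only (the `η`-symmetry is exact there); nothing here concerns d-wave pairing.
The benchmark literature (Hirsch 1985 Table II; White et al. 1989) reports these correlators at the `10⁻²`
level at distance ≥ 2, well inside the ceilings.

## References
* S.-C. Zhang, Phys. Rev. Lett. 65 (1990) 120; Phys. Rev. B 42 (1990) 1012. [cite: Zhang1990] [cite: ZhangPRB1990]
* C. N. Yang, S.-C. Zhang, Mod. Phys. Lett. B 4 (1990) 759, Theorem 1. [cite: YangZhang1990, Theorem 1]
* E. H. Lieb, M. Loss, R. J. McCann, J. Math. Phys. 34 (1993) 891, Theorem eq. (5). [cite: LiebLossMccann1993, Theorem eq. (5)]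
* J. E. Hirsch, Phys. Rev. B 31 (1985) 4403, Table II. [cite: HirschPRB1985, Table II]
* T. Koma, H. Tasaki, J. Stat. Phys. 76 (1994) 745, §1. [cite: KomaTasaki1994, §1]
-/

noncomputable section

namespace Summit.HubbardSuperconductivity.HubbardLadder

open Literature.MathematicalPhysics.QuantumLattice Matrix

open Bounds

/-! ### Certificate-free rows (every `U > 0`): uniform density and the charge/pair identity -/

/-- **R2 row B7.n (every `U > 0`)**: `⟨ψ, n_{xσ} ψ⟩ = ½` at every site and spin of the half-filled `4 × 4`
torus ground state (unit vector). [cite: LiebLossMccann1993, Theorem eq. (5)] -/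
theorem numberOp_four_eq_half {U : ℝ} (hU : 0 < U) {ψ : Fock (Orb (FermionTorus 2 4))}
    (hψ : IsGroundState (hamiltonian (fermionTorusGraph 2 4) 1 U) 16 ψ) (hψ1 : star ψ ⬝ᵥ ψ = 1)
    (x : FermionTorus 2 4) (σ : Fin 2) : expect (numberOp x σ) ψ = 1 / 2 := by
  have hψ' : IsGroundState (hamiltonian (fermionTorusGraph 2 4) 1 U) (4 ^ 2) ψ := by simpa using hψ
  have h := hubbardTorus_expect_numberOp_eq_half (L := 4) (by decide) one_ne_zero hU hψ' x σ
  rw [hψ1, mul_one] at h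
  exact h

/-- **R2 row B7.n′ (every `U > 0`)**: density exactly one, `⟨ψ, (n_{x↑} + n_{x↓}) ψ⟩ = 1`, at every site.
[cite: LiebLossMccann1993, Theorem eq. (5)] -/
theorem siteNumber_four_eq_one {U : ℝ} (hU : 0 < U) {ψ : Fock (Orb (FermionTorus 2 4))}
    (hψ : IsGroundState (hamiltonian (fermionTorusGraph 2 4) 1 U) 16 ψ) (hψ1 : star ψ ⬝ᵥ ψ = 1)
    (x : FermionTorus 2 4) : expect (numberOp x 0 + numberOp x 1) ψ = 1 := by
  have hψ' : IsGroundState (hamiltonian (fermionTorusGraph 2 4) 1 U) (4 ^ 2) ψ := by simpa using hψ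
  rw [hubbardTorus_expect_siteNumber_eq (L := 4) (by decide) one_ne_zero hU hψ' x, hψ1]

/-- **R2 row B7.id (every `U > 0`, `r ≠ 0`)**: the translation-summed charge correlator equals `2 ε_r` times
the translation-summed on-site pair correlator,
`Σ_x ⟨(n_x - 1)(n_{x+r} - 1)⟩ = 2 (-1)^{r₁+r₂} Σ_x ⟨c†_{x↑} c†_{x↓} c_{x+r,↓} c_{x+r,↑}⟩`. [cite: Zhang1990]
[cite: YangZhang1990, Theorem 1] -/
theorem chargeCorrSum_four_eq_two_mul_stagger_mul_pairSum {U : ℝ} (hU : 0 < U)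
    {ψ : Fock (Orb (FermionTorus 2 4))} (hψ : IsGroundState (hamiltonian (fermionTorusGraph 2 4) 1 U) 16 ψ)
    {r : FermionTorus 2 4} (hr : r ≠ 0) :
    ∑ x : FermionTorus 2 4, expect ((numberOp x 0 + numberOp x 1 - 1) *
        (numberOp (x + r) 0 + numberOp (x + r) 1 - 1)) ψ =
      2 * ((torusStagger r : ℤ) : ℂ) * ∑ x : FermionTorus 2 4,
        expect (creation (orb x 0) * creation (orb x 1) *
          (annihilation (orb (x + r) 1) * annihilation (orb (x + r) 0))) ψ := by
  have hψ' : IsGroundState (hamiltonian (fermionTorusGraph 2 4) 1 U) (4 ^ 2) ψ := by simpa using hψ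
  exact hubbardTorus_sum_expect_chargeDev_translate_eq (L := 4) (by decide) one_ne_zero hU hψ' hr

/-- **R2 row B7.id′ (every `U > 0`, `r ≠ 0`)**: `Σ_x ⟨n_x n_{x+r}⟩ - 16 = 2 ε_r Σ_x ⟨Δ†_x Δ_{x+r}⟩` in a unit
ground state. [cite: Zhang1990] [cite: LiebLossMccann1993, Theorem eq. (5)] -/
theorem densityCorrSum_four_sub_eq_two_mul_stagger_mul_pairSum {U : ℝ} (hU : 0 < U)
    {ψ : Fock (Orb (FermionTorus 2 4))} (hψ : IsGroundState (hamiltonian (fermionTorusGraph 2 4) 1 U) 16 ψ)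
    (hψ1 : star ψ ⬝ᵥ ψ = 1) {r : FermionTorus 2 4} (hr : r ≠ 0) :
    ∑ x : FermionTorus 2 4, expect ((numberOp x 0 + numberOp x 1) * (numberOp (x + r) 0 + numberOp (x + r) 1)) ψ
        - 16 =
      2 * ((torusStagger r : ℤ) : ℂ) * ∑ x : FermionTorus 2 4,
        expect (creation (orb x 0) * creation (orb x 1) *
          (annihilation (orb (x + r) 1) * annihilation (orb (x + r) 0))) ψ := by
  have hψ' : IsGroundState (hamiltonian (fermionTorusGraph 2 4) 1 U) (4 ^ 2) ψ := by simpa using hψ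
  have h := (hubbardTorus_sum_expect_siteNumber_translate (L := 4) (by decide) one_ne_zero hU hψ' hr).1
  have hc : (Fintype.card (FermionTorus 2 4) : ℂ) = 16 := by
    rw [show Fintype.card (FermionTorus 2 4) = 4 ^ 2 by
      simp only [FermionTorus, Fintype.card_lex, Fintype.card_fun, Fintype.card_fin]]
    norm_num
  rw [hc, hψ1, mul_one] at h
  exact h

/-! ### The kernel: a ceiling on `d` is a ceiling on the pair, charge and density correlators at every distance -/

/-- **D10 kernel on the `4 × 4` torus**: if `⟨D̂⟩_ψ/16 ≤ c` in a half-filled unit ground state then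
(i) `|Σ_x ⟨Δ†_x Δ_{x+r}⟩|/16 ≤ c` for every `r`, (ii) `|Σ_x ⟨(n_x - 1)(n_{x+r} - 1)⟩|/16 ≤ 2c` and
(iii) `|Σ_x ⟨n_x n_{x+r}⟩/16 - 1| ≤ 2c` for every `r ≠ 0`. [cite: Zhang1990] [cite: ZhangPRB1990]
[cite: LiebLossMccann1993, Theorem eq. (5)] -/
theorem pair_charge_density_ceilings_of_doubleOcc_le {U : ℝ} (hU : 0 < U)
    {ψ : Fock (Orb (FermionTorus 2 4))} (hψ : IsGroundState (hamiltonian (fermionTorusGraph 2 4) 1 U) 16 ψ)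
    (hψ1 : star ψ ⬝ᵥ ψ = 1) {c : ℝ}
    (hd : (expect (∑ x : FermionTorus 2 4, numberOp x 0 * numberOp x 1) ψ).re / 16 ≤ c) :
    (∀ r : FermionTorus 2 4, ‖∑ x : FermionTorus 2 4, expect (creation (orb x 0) * creation (orb x 1) *
        (annihilation (orb (x + r) 1) * annihilation (orb (x + r) 0))) ψ‖ / 16 ≤ c) ∧
    (∀ r : FermionTorus 2 4, r ≠ 0 → ‖∑ x : FermionTorus 2 4, expect ((numberOp x 0 + numberOp x 1 - 1) *
        (numberOp (x + r) 0 + numberOp (x + r) 1 - 1)) ψ‖ / 16 ≤ 2 * c) ∧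
    (∀ r : FermionTorus 2 4, r ≠ 0 → ‖(∑ x : FermionTorus 2 4, expect ((numberOp x 0 + numberOp x 1) *
        (numberOp (x + r) 0 + numberOp (x + r) 1)) ψ) / 16 - 1‖ ≤ 2 * c) := by
  have hψ' : IsGroundState (hamiltonian (fermionTorusGraph 2 4) 1 U) (4 ^ 2) ψ := by simpa using hψ
  have hc : (Fintype.card (FermionTorus 2 4) : ℂ) = 16 := by
    rw [show Fintype.card (FermionTorus 2 4) = 4 ^ 2 by
      simp only [FermionTorus, Fintype.card_lex, Fintype.card_fun, Fintype.card_fin]]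
    norm_num
  refine ⟨fun r => ?_, fun r hr => ?_, fun r hr => ?_⟩
  · have h := norm_sum_expect_pair_translate_le r ψ
    linarith
  · have h := (hubbardTorus_norm_sum_expect_chargeDev_translate_le (L := 4) (by decide) one_ne_zero hU hψ' hr).2
    linarith
  · have h := (hubbardTorus_sum_expect_siteNumber_translate (L := 4) (by decide) one_ne_zero hU hψ' hr).2
    rw [hc, hψ1, mul_one] at h
    rw [show (∑ x : FermionTorus 2 4, expect ((numberOp x 0 + numberOp x 1) *
        (numberOp (x + r) 0 + numberOp (x + r) 1)) ψ) / 16 - 1 =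
        (∑ x : FermionTorus 2 4, expect ((numberOp x 0 + numberOp x 1) *
          (numberOp (x + r) 0 + numberOp (x + r) 1)) ψ - 16) / 16 by ring, norm_div,
      show ‖(16 : ℂ)‖ = 16 by simp]
    linarith

/-! ### `U = 2` -/
/-- **R2 row B7.P at `U = 2`, claim form** (1 node: E2 upper at this U): the translation-averaged on-site s-wave pair correlator
`(1/16)|Σ_x ⟨c†_{x↑} c†_{x↓} c_{x+r,↓} c_{x+r,↑}⟩| ≤ 0.1870` at EVERY displacement `r`. [cite: ZhangPRB1990]
[cite: KomaTasaki1994, §1] -/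
theorem pairSum_four_U2_norm_le_of_claim {ψ : Fock (Orb (FermionTorus 2 4))}
    (hψ : IsGroundState (hamiltonian (fermionTorusGraph 2 4) 1 2) 16 ψ) (hψ1 : star ψ ⬝ᵥ ψ = 1)
    (h₂ : torusUpper_mbbootE2_4x4_U2_N16) (r : FermionTorus 2 4) :
    ‖∑ x : FermionTorus 2 4, expect (creation (orb x 0) * creation (orb x 1) *
        (annihilation (orb (x + r) 1) * annihilation (orb (x + r) 0))) ψ‖ / 16 ≤ (0.1870 : ℝ) :=
  (pair_charge_density_ceilings_of_doubleOcc_le (by norm_num) hψ hψ1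
    (doubleOcc_four_U2_mem_Icc_of_claim hψ hψ1 h₂).2).1 r

/-- **R2 row B7.C at `U = 2`, claim form** (1 node: E2 upper at this U): the translation-averaged charge correlator
`(1/16)|Σ_x ⟨(n_x - 1)(n_{x+r} - 1)⟩| ≤ 0.3740` at every `r ≠ 0`. [cite: Zhang1990] [cite: KomaTasaki1994, §1] -/
theorem chargeCorrSum_four_U2_norm_le_of_claim {ψ : Fock (Orb (FermionTorus 2 4))}
    (hψ : IsGroundState (hamiltonian (fermionTorusGraph 2 4) 1 2) 16 ψ) (hψ1 : star ψ ⬝ᵥ ψ = 1)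
    (h₂ : torusUpper_mbbootE2_4x4_U2_N16) {r : FermionTorus 2 4} (hr : r ≠ 0) :
    ‖∑ x : FermionTorus 2 4, expect ((numberOp x 0 + numberOp x 1 - 1) *
        (numberOp (x + r) 0 + numberOp (x + r) 1 - 1)) ψ‖ / 16 ≤ (0.3740 : ℝ) :=
  le_trans ((pair_charge_density_ceilings_of_doubleOcc_le (by norm_num) hψ hψ1
    (doubleOcc_four_U2_mem_Icc_of_claim hψ hψ1 h₂).2).2.1 r hr) (by norm_num)

/-- **R2 row B7.N at `U = 2`, claim form** (1 node: E2 upper at this U): the connected density–density correlator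
`|(1/16) Σ_x ⟨n_x n_{x+r}⟩ - 1| ≤ 0.3740` at every `r ≠ 0` (`⟨n_x⟩ = 1` exactly). [cite: LiebLossMccann1993, Theorem eq. (5)]
[cite: HirschPRB1985, Table II] -/
theorem densityCorrSum_four_U2_norm_le_of_claim {ψ : Fock (Orb (FermionTorus 2 4))}
    (hψ : IsGroundState (hamiltonian (fermionTorusGraph 2 4) 1 2) 16 ψ) (hψ1 : star ψ ⬝ᵥ ψ = 1)
    (h₂ : torusUpper_mbbootE2_4x4_U2_N16) {r : FermionTorus 2 4} (hr : r ≠ 0) :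
    ‖(∑ x : FermionTorus 2 4, expect ((numberOp x 0 + numberOp x 1) *
        (numberOp (x + r) 0 + numberOp (x + r) 1)) ψ) / 16 - 1‖ ≤ (0.3740 : ℝ) :=
  le_trans ((pair_charge_density_ceilings_of_doubleOcc_le (by norm_num) hψ hψ1
    (doubleOcc_four_U2_mem_Icc_of_claim hψ hψ1 h₂).2).2.2 r hr) (by norm_num)

/-! ### `U = 4` -/
/-- **R2 row B7.P at `U = 4`, claim form** (1 node: E2 upper at this U): the translation-averaged on-site s-wave pair correlator
`(1/16)|Σ_x ⟨c†_{x↑} c†_{x↓} c_{x+r,↓} c_{x+r,↑}⟩| ≤ 0.1622` at EVERY displacement `r`. [cite: ZhangPRB1990]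
[cite: KomaTasaki1994, §1] -/
theorem pairSum_four_U4_norm_le_of_claim {ψ : Fock (Orb (FermionTorus 2 4))}
    (hψ : IsGroundState (hamiltonian (fermionTorusGraph 2 4) 1 4) 16 ψ) (hψ1 : star ψ ⬝ᵥ ψ = 1)
    (h₄ : torusUpper_mbbootE2_4x4_U4_N16) (r : FermionTorus 2 4) :
    ‖∑ x : FermionTorus 2 4, expect (creation (orb x 0) * creation (orb x 1) *
        (annihilation (orb (x + r) 1) * annihilation (orb (x + r) 0))) ψ‖ / 16 ≤ (0.1622 : ℝ) :=
  (pair_charge_density_ceilings_of_doubleOcc_le (by norm_num) hψ hψ1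
    (doubleOcc_four_U4_mem_Icc_of_claim hψ hψ1 h₄).2).1 r

/-- **R2 row B7.C at `U = 4`, claim form** (1 node: E2 upper at this U): the translation-averaged charge correlator
`(1/16)|Σ_x ⟨(n_x - 1)(n_{x+r} - 1)⟩| ≤ 0.3244` at every `r ≠ 0`. [cite: Zhang1990] [cite: KomaTasaki1994, §1] -/
theorem chargeCorrSum_four_U4_norm_le_of_claim {ψ : Fock (Orb (FermionTorus 2 4))}
    (hψ : IsGroundState (hamiltonian (fermionTorusGraph 2 4) 1 4) 16 ψ) (hψ1 : star ψ ⬝ᵥ ψ = 1)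
    (h₄ : torusUpper_mbbootE2_4x4_U4_N16) {r : FermionTorus 2 4} (hr : r ≠ 0) :
    ‖∑ x : FermionTorus 2 4, expect ((numberOp x 0 + numberOp x 1 - 1) *
        (numberOp (x + r) 0 + numberOp (x + r) 1 - 1)) ψ‖ / 16 ≤ (0.3244 : ℝ) :=
  le_trans ((pair_charge_density_ceilings_of_doubleOcc_le (by norm_num) hψ hψ1
    (doubleOcc_four_U4_mem_Icc_of_claim hψ hψ1 h₄).2).2.1 r hr) (by norm_num)

/-- **R2 row B7.N at `U = 4`, claim form** (1 node: E2 upper at this U): the connected density–density correlator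
`|(1/16) Σ_x ⟨n_x n_{x+r}⟩ - 1| ≤ 0.3244` at every `r ≠ 0` (`⟨n_x⟩ = 1` exactly). [cite: LiebLossMccann1993, Theorem eq. (5)]
[cite: HirschPRB1985, Table II] -/
theorem densityCorrSum_four_U4_norm_le_of_claim {ψ : Fock (Orb (FermionTorus 2 4))}
    (hψ : IsGroundState (hamiltonian (fermionTorusGraph 2 4) 1 4) 16 ψ) (hψ1 : star ψ ⬝ᵥ ψ = 1)
    (h₄ : torusUpper_mbbootE2_4x4_U4_N16) {r : FermionTorus 2 4} (hr : r ≠ 0) :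
    ‖(∑ x : FermionTorus 2 4, expect ((numberOp x 0 + numberOp x 1) *
        (numberOp (x + r) 0 + numberOp (x + r) 1)) ψ) / 16 - 1‖ ≤ (0.3244 : ℝ) :=
  le_trans ((pair_charge_density_ceilings_of_doubleOcc_le (by norm_num) hψ hψ1
    (doubleOcc_four_U4_mem_Icc_of_claim hψ hψ1 h₄).2).2.2 r hr) (by norm_num)

/-- **R2 row B7.P at `U = 4`, claim form** (3 nodes): the translation-averaged on-site s-wave pair correlator
`(1/16)|Σ_x ⟨c†_{x↑} c†_{x↓} c_{x+r,↓} c_{x+r,↑}⟩| ≤ 0.1422` at EVERY displacement `r`. [cite: ZhangPRB1990]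
[cite: KomaTasaki1994, §1] -/
theorem pairSum_four_U4_norm_le_of_claims {ψ : Fock (Orb (FermionTorus 2 4))}
    (hψ : IsGroundState (hamiltonian (fermionTorusGraph 2 4) 1 4) 16 ψ) (hψ1 : star ψ ⬝ᵥ ψ = 1)
    (h₂ : torusLower_mbboot_4x4_U2_N16) (h₄ : torusUpper_mbbootE2_4x4_U4_N16)
    (h₆ : torusLower_mbboot_4x4_U6_N16) (r : FermionTorus 2 4) :
    ‖∑ x : FermionTorus 2 4, expect (creation (orb x 0) * creation (orb x 1) *
        (annihilation (orb (x + r) 1) * annihilation (orb (x + r) 0))) ψ‖ / 16 ≤ (0.1422 : ℝ) :=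
  (pair_charge_density_ceilings_of_doubleOcc_le (by norm_num) hψ hψ1
    (doubleOcc_four_U4_mem_Icc_of_claims hψ hψ1 h₂ h₄ h₆).2).1 r

/-- **R2 row B7.C at `U = 4`, claim form** (3 nodes): the translation-averaged charge correlator
`(1/16)|Σ_x ⟨(n_x - 1)(n_{x+r} - 1)⟩| ≤ 0.2844` at every `r ≠ 0`. [cite: Zhang1990] [cite: KomaTasaki1994, §1] -/
theorem chargeCorrSum_four_U4_norm_le_of_claims {ψ : Fock (Orb (FermionTorus 2 4))}
    (hψ : IsGroundState (hamiltonian (fermionTorusGraph 2 4) 1 4) 16 ψ) (hψ1 : star ψ ⬝ᵥ ψ = 1)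
    (h₂ : torusLower_mbboot_4x4_U2_N16) (h₄ : torusUpper_mbbootE2_4x4_U4_N16)
    (h₆ : torusLower_mbboot_4x4_U6_N16) {r : FermionTorus 2 4} (hr : r ≠ 0) :
    ‖∑ x : FermionTorus 2 4, expect ((numberOp x 0 + numberOp x 1 - 1) *
        (numberOp (x + r) 0 + numberOp (x + r) 1 - 1)) ψ‖ / 16 ≤ (0.2844 : ℝ) :=
  le_trans ((pair_charge_density_ceilings_of_doubleOcc_le (by norm_num) hψ hψ1
    (doubleOcc_four_U4_mem_Icc_of_claims hψ hψ1 h₂ h₄ h₆).2).2.1 r hr) (by norm_num)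

/-- **R2 row B7.N at `U = 4`, claim form** (3 nodes): the connected density–density correlator
`|(1/16) Σ_x ⟨n_x n_{x+r}⟩ - 1| ≤ 0.2844` at every `r ≠ 0` (`⟨n_x⟩ = 1` exactly). [cite: LiebLossMccann1993, Theorem eq. (5)]
[cite: HirschPRB1985, Table II] -/
theorem densityCorrSum_four_U4_norm_le_of_claims {ψ : Fock (Orb (FermionTorus 2 4))}
    (hψ : IsGroundState (hamiltonian (fermionTorusGraph 2 4) 1 4) 16 ψ) (hψ1 : star ψ ⬝ᵥ ψ = 1)
    (h₂ : torusLower_mbboot_4x4_U2_N16) (h₄ : torusUpper_mbbootE2_4x4_U4_N16)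
    (h₆ : torusLower_mbboot_4x4_U6_N16) {r : FermionTorus 2 4} (hr : r ≠ 0) :
    ‖(∑ x : FermionTorus 2 4, expect ((numberOp x 0 + numberOp x 1) *
        (numberOp (x + r) 0 + numberOp (x + r) 1)) ψ) / 16 - 1‖ ≤ (0.2844 : ℝ) :=
  le_trans ((pair_charge_density_ceilings_of_doubleOcc_le (by norm_num) hψ hψ1
    (doubleOcc_four_U4_mem_Icc_of_claims hψ hψ1 h₂ h₄ h₆).2).2.2 r hr) (by norm_num)

/-! ### `U = 6` -/
/-- **R2 row B7.P at `U = 6`, claim form** (1 node: E2 upper at this U): the translation-averaged on-site s-wave pair correlator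
`(1/16)|Σ_x ⟨c†_{x↑} c†_{x↓} c_{x+r,↓} c_{x+r,↑}⟩| ≤ 0.1386` at EVERY displacement `r`. [cite: ZhangPRB1990]
[cite: KomaTasaki1994, §1] -/
theorem pairSum_four_U6_norm_le_of_claim {ψ : Fock (Orb (FermionTorus 2 4))}
    (hψ : IsGroundState (hamiltonian (fermionTorusGraph 2 4) 1 6) 16 ψ) (hψ1 : star ψ ⬝ᵥ ψ = 1)
    (h₆ : torusUpper_mbbootE2_4x4_U6_N16) (r : FermionTorus 2 4) :
    ‖∑ x : FermionTorus 2 4, expect (creation (orb x 0) * creation (orb x 1) *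
        (annihilation (orb (x + r) 1) * annihilation (orb (x + r) 0))) ψ‖ / 16 ≤ (0.1386 : ℝ) :=
  (pair_charge_density_ceilings_of_doubleOcc_le (by norm_num) hψ hψ1
    (doubleOcc_four_U6_mem_Icc_of_claim hψ hψ1 h₆).2).1 r

/-- **R2 row B7.C at `U = 6`, claim form** (1 node: E2 upper at this U): the translation-averaged charge correlator
`(1/16)|Σ_x ⟨(n_x - 1)(n_{x+r} - 1)⟩| ≤ 0.2772` at every `r ≠ 0`. [cite: Zhang1990] [cite: KomaTasaki1994, §1] -/
theorem chargeCorrSum_four_U6_norm_le_of_claim {ψ : Fock (Orb (FermionTorus 2 4))}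
    (hψ : IsGroundState (hamiltonian (fermionTorusGraph 2 4) 1 6) 16 ψ) (hψ1 : star ψ ⬝ᵥ ψ = 1)
    (h₆ : torusUpper_mbbootE2_4x4_U6_N16) {r : FermionTorus 2 4} (hr : r ≠ 0) :
    ‖∑ x : FermionTorus 2 4, expect ((numberOp x 0 + numberOp x 1 - 1) *
        (numberOp (x + r) 0 + numberOp (x + r) 1 - 1)) ψ‖ / 16 ≤ (0.2772 : ℝ) :=
  le_trans ((pair_charge_density_ceilings_of_doubleOcc_le (by norm_num) hψ hψ1
    (doubleOcc_four_U6_mem_Icc_of_claim hψ hψ1 h₆).2).2.1 r hr) (by norm_num)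

/-- **R2 row B7.N at `U = 6`, claim form** (1 node: E2 upper at this U): the connected density–density correlator
`|(1/16) Σ_x ⟨n_x n_{x+r}⟩ - 1| ≤ 0.2772` at every `r ≠ 0` (`⟨n_x⟩ = 1` exactly). [cite: LiebLossMccann1993, Theorem eq. (5)]
[cite: HirschPRB1985, Table II] -/
theorem densityCorrSum_four_U6_norm_le_of_claim {ψ : Fock (Orb (FermionTorus 2 4))}
    (hψ : IsGroundState (hamiltonian (fermionTorusGraph 2 4) 1 6) 16 ψ) (hψ1 : star ψ ⬝ᵥ ψ = 1)
    (h₆ : torusUpper_mbbootE2_4x4_U6_N16) {r : FermionTorus 2 4} (hr : r ≠ 0) :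
    ‖(∑ x : FermionTorus 2 4, expect ((numberOp x 0 + numberOp x 1) *
        (numberOp (x + r) 0 + numberOp (x + r) 1)) ψ) / 16 - 1‖ ≤ (0.2772 : ℝ) :=
  le_trans ((pair_charge_density_ceilings_of_doubleOcc_le (by norm_num) hψ hψ1
    (doubleOcc_four_U6_mem_Icc_of_claim hψ hψ1 h₆).2).2.2 r hr) (by norm_num)

/-- **R2 row B7.P at `U = 6`, claim form** (3 nodes): the translation-averaged on-site s-wave pair correlator
`(1/16)|Σ_x ⟨c†_{x↑} c†_{x↓} c_{x+r,↓} c_{x+r,↑}⟩| ≤ 0.1090` at EVERY displacement `r`. [cite: ZhangPRB1990]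
[cite: KomaTasaki1994, §1] -/
theorem pairSum_four_U6_norm_le_of_claims {ψ : Fock (Orb (FermionTorus 2 4))}
    (hψ : IsGroundState (hamiltonian (fermionTorusGraph 2 4) 1 6) 16 ψ) (hψ1 : star ψ ⬝ᵥ ψ = 1)
    (h₄ : torusLower_mbboot_4x4_U4_N16) (h₆ : torusUpper_mbbootE2_4x4_U6_N16)
    (h₈ : torusLower_mbboot_4x4_U8_N16) (r : FermionTorus 2 4) :
    ‖∑ x : FermionTorus 2 4, expect (creation (orb x 0) * creation (orb x 1) *
        (annihilation (orb (x + r) 1) * annihilation (orb (x + r) 0))) ψ‖ / 16 ≤ (0.1090 : ℝ) :=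
  (pair_charge_density_ceilings_of_doubleOcc_le (by norm_num) hψ hψ1
    (doubleOcc_four_U6_mem_Icc_of_claims hψ hψ1 h₄ h₆ h₈).2).1 r

/-- **R2 row B7.C at `U = 6`, claim form** (3 nodes): the translation-averaged charge correlator
`(1/16)|Σ_x ⟨(n_x - 1)(n_{x+r} - 1)⟩| ≤ 0.2180` at every `r ≠ 0`. [cite: Zhang1990] [cite: KomaTasaki1994, §1] -/
theorem chargeCorrSum_four_U6_norm_le_of_claims {ψ : Fock (Orb (FermionTorus 2 4))}
    (hψ : IsGroundState (hamiltonian (fermionTorusGraph 2 4) 1 6) 16 ψ) (hψ1 : star ψ ⬝ᵥ ψ = 1)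
    (h₄ : torusLower_mbboot_4x4_U4_N16) (h₆ : torusUpper_mbbootE2_4x4_U6_N16)
    (h₈ : torusLower_mbboot_4x4_U8_N16) {r : FermionTorus 2 4} (hr : r ≠ 0) :
    ‖∑ x : FermionTorus 2 4, expect ((numberOp x 0 + numberOp x 1 - 1) *
        (numberOp (x + r) 0 + numberOp (x + r) 1 - 1)) ψ‖ / 16 ≤ (0.2180 : ℝ) :=
  le_trans ((pair_charge_density_ceilings_of_doubleOcc_le (by norm_num) hψ hψ1
    (doubleOcc_four_U6_mem_Icc_of_claims hψ hψ1 h₄ h₆ h₈).2).2.1 r hr) (by norm_num)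

/-- **R2 row B7.N at `U = 6`, claim form** (3 nodes): the connected density–density correlator
`|(1/16) Σ_x ⟨n_x n_{x+r}⟩ - 1| ≤ 0.2180` at every `r ≠ 0` (`⟨n_x⟩ = 1` exactly). [cite: LiebLossMccann1993, Theorem eq. (5)]
[cite: HirschPRB1985, Table II] -/
theorem densityCorrSum_four_U6_norm_le_of_claims {ψ : Fock (Orb (FermionTorus 2 4))}
    (hψ : IsGroundState (hamiltonian (fermionTorusGraph 2 4) 1 6) 16 ψ) (hψ1 : star ψ ⬝ᵥ ψ = 1)
    (h₄ : torusLower_mbboot_4x4_U4_N16) (h₆ : torusUpper_mbbootE2_4x4_U6_N16)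
    (h₈ : torusLower_mbboot_4x4_U8_N16) {r : FermionTorus 2 4} (hr : r ≠ 0) :
    ‖(∑ x : FermionTorus 2 4, expect ((numberOp x 0 + numberOp x 1) *
        (numberOp (x + r) 0 + numberOp (x + r) 1)) ψ) / 16 - 1‖ ≤ (0.2180 : ℝ) :=
  le_trans ((pair_charge_density_ceilings_of_doubleOcc_le (by norm_num) hψ hψ1
    (doubleOcc_four_U6_mem_Icc_of_claims hψ hψ1 h₄ h₆ h₈).2).2.2 r hr) (by norm_num)

/-! ### `U = 8` -/
/-- **R2 row B7.P at `U = 8`, claim form** (1 node: E2 upper at this U): the translation-averaged on-site s-wave pair correlator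
`(1/16)|Σ_x ⟨c†_{x↑} c†_{x↓} c_{x+r,↓} c_{x+r,↑}⟩| ≤ 0.1153` at EVERY displacement `r`. [cite: ZhangPRB1990]
[cite: KomaTasaki1994, §1] -/
theorem pairSum_four_U8_norm_le_of_claim {ψ : Fock (Orb (FermionTorus 2 4))}
    (hψ : IsGroundState (hamiltonian (fermionTorusGraph 2 4) 1 8) 16 ψ) (hψ1 : star ψ ⬝ᵥ ψ = 1)
    (h₈ : torusUpper_mbbootE2_4x4_U8_N16) (r : FermionTorus 2 4) :
    ‖∑ x : FermionTorus 2 4, expect (creation (orb x 0) * creation (orb x 1) *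
        (annihilation (orb (x + r) 1) * annihilation (orb (x + r) 0))) ψ‖ / 16 ≤ (0.1153 : ℝ) :=
  (pair_charge_density_ceilings_of_doubleOcc_le (by norm_num) hψ hψ1
    (doubleOcc_four_U8_mem_Icc_of_claim hψ hψ1 h₈).2).1 r

/-- **R2 row B7.C at `U = 8`, claim form** (1 node: E2 upper at this U): the translation-averaged charge correlator
`(1/16)|Σ_x ⟨(n_x - 1)(n_{x+r} - 1)⟩| ≤ 0.2306` at every `r ≠ 0`. [cite: Zhang1990] [cite: KomaTasaki1994, §1] -/
theorem chargeCorrSum_four_U8_norm_le_of_claim {ψ : Fock (Orb (FermionTorus 2 4))}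
    (hψ : IsGroundState (hamiltonian (fermionTorusGraph 2 4) 1 8) 16 ψ) (hψ1 : star ψ ⬝ᵥ ψ = 1)
    (h₈ : torusUpper_mbbootE2_4x4_U8_N16) {r : FermionTorus 2 4} (hr : r ≠ 0) :
    ‖∑ x : FermionTorus 2 4, expect ((numberOp x 0 + numberOp x 1 - 1) *
        (numberOp (x + r) 0 + numberOp (x + r) 1 - 1)) ψ‖ / 16 ≤ (0.2306 : ℝ) :=
  le_trans ((pair_charge_density_ceilings_of_doubleOcc_le (by norm_num) hψ hψ1
    (doubleOcc_four_U8_mem_Icc_of_claim hψ hψ1 h₈).2).2.1 r hr) (by norm_num)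

/-- **R2 row B7.N at `U = 8`, claim form** (1 node: E2 upper at this U): the connected density–density correlator
`|(1/16) Σ_x ⟨n_x n_{x+r}⟩ - 1| ≤ 0.2306` at every `r ≠ 0` (`⟨n_x⟩ = 1` exactly). [cite: LiebLossMccann1993, Theorem eq. (5)]
[cite: HirschPRB1985, Table II] -/
theorem densityCorrSum_four_U8_norm_le_of_claim {ψ : Fock (Orb (FermionTorus 2 4))}
    (hψ : IsGroundState (hamiltonian (fermionTorusGraph 2 4) 1 8) 16 ψ) (hψ1 : star ψ ⬝ᵥ ψ = 1)
    (h₈ : torusUpper_mbbootE2_4x4_U8_N16) {r : FermionTorus 2 4} (hr : r ≠ 0) :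
    ‖(∑ x : FermionTorus 2 4, expect ((numberOp x 0 + numberOp x 1) *
        (numberOp (x + r) 0 + numberOp (x + r) 1)) ψ) / 16 - 1‖ ≤ (0.2306 : ℝ) :=
  le_trans ((pair_charge_density_ceilings_of_doubleOcc_le (by norm_num) hψ hψ1
    (doubleOcc_four_U8_mem_Icc_of_claim hψ hψ1 h₈).2).2.2 r hr) (by norm_num)

/-- **R2 row B7.P at `U = 8`, claim form** (3 nodes): the translation-averaged on-site s-wave pair correlator
`(1/16)|Σ_x ⟨c†_{x↑} c†_{x↓} c_{x+r,↓} c_{x+r,↑}⟩| ≤ 0.0827` at EVERY displacement `r`. [cite: ZhangPRB1990]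
[cite: KomaTasaki1994, §1] -/
theorem pairSum_four_U8_norm_le_of_claims {ψ : Fock (Orb (FermionTorus 2 4))}
    (hψ : IsGroundState (hamiltonian (fermionTorusGraph 2 4) 1 8) 16 ψ) (hψ1 : star ψ ⬝ᵥ ψ = 1)
    (h₆ : torusLower_mbboot_4x4_U6_N16) (h₈ : torusUpper_mbbootE2_4x4_U8_N16)
    (h₁₂ : torusLower_mbboot_4x4_U12_N16) (r : FermionTorus 2 4) :
    ‖∑ x : FermionTorus 2 4, expect (creation (orb x 0) * creation (orb x 1) *
        (annihilation (orb (x + r) 1) * annihilation (orb (x + r) 0))) ψ‖ / 16 ≤ (0.0827 : ℝ) :=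
  (pair_charge_density_ceilings_of_doubleOcc_le (by norm_num) hψ hψ1
    (doubleOcc_four_U8_mem_Icc_of_claims hψ hψ1 h₆ h₈ h₁₂).2).1 r

/-- **R2 row B7.C at `U = 8`, claim form** (3 nodes): the translation-averaged charge correlator
`(1/16)|Σ_x ⟨(n_x - 1)(n_{x+r} - 1)⟩| ≤ 0.1654` at every `r ≠ 0`. [cite: Zhang1990] [cite: KomaTasaki1994, §1] -/
theorem chargeCorrSum_four_U8_norm_le_of_claims {ψ : Fock (Orb (FermionTorus 2 4))}
    (hψ : IsGroundState (hamiltonian (fermionTorusGraph 2 4) 1 8) 16 ψ) (hψ1 : star ψ ⬝ᵥ ψ = 1)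
    (h₆ : torusLower_mbboot_4x4_U6_N16) (h₈ : torusUpper_mbbootE2_4x4_U8_N16)
    (h₁₂ : torusLower_mbboot_4x4_U12_N16) {r : FermionTorus 2 4} (hr : r ≠ 0) :
    ‖∑ x : FermionTorus 2 4, expect ((numberOp x 0 + numberOp x 1 - 1) *
        (numberOp (x + r) 0 + numberOp (x + r) 1 - 1)) ψ‖ / 16 ≤ (0.1654 : ℝ) :=
  le_trans ((pair_charge_density_ceilings_of_doubleOcc_le (by norm_num) hψ hψ1
    (doubleOcc_four_U8_mem_Icc_of_claims hψ hψ1 h₆ h₈ h₁₂).2).2.1 r hr) (by norm_num)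

/-- **R2 row B7.N at `U = 8`, claim form** (3 nodes): the connected density–density correlator
`|(1/16) Σ_x ⟨n_x n_{x+r}⟩ - 1| ≤ 0.1654` at every `r ≠ 0` (`⟨n_x⟩ = 1` exactly). [cite: LiebLossMccann1993, Theorem eq. (5)]
[cite: HirschPRB1985, Table II] -/
theorem densityCorrSum_four_U8_norm_le_of_claims {ψ : Fock (Orb (FermionTorus 2 4))}
    (hψ : IsGroundState (hamiltonian (fermionTorusGraph 2 4) 1 8) 16 ψ) (hψ1 : star ψ ⬝ᵥ ψ = 1)
    (h₆ : torusLower_mbboot_4x4_U6_N16) (h₈ : torusUpper_mbbootE2_4x4_U8_N16)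
    (h₁₂ : torusLower_mbboot_4x4_U12_N16) {r : FermionTorus 2 4} (hr : r ≠ 0) :
    ‖(∑ x : FermionTorus 2 4, expect ((numberOp x 0 + numberOp x 1) *
        (numberOp (x + r) 0 + numberOp (x + r) 1)) ψ) / 16 - 1‖ ≤ (0.1654 : ℝ) :=
  le_trans ((pair_charge_density_ceilings_of_doubleOcc_le (by norm_num) hψ hψ1
    (doubleOcc_four_U8_mem_Icc_of_claims hψ hψ1 h₆ h₈ h₁₂).2).2.2 r hr) (by norm_num)

end Summit.HubbardSuperconductivity.HubbardLadder
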